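import Summits.CriticalPhenomena.Ising3DConformalLimit.Theses.PerfectScreening
import Summits.CriticalPhenomena.Ising3DConformalLimit.Theses.PrecisionLaplacian
import Summits.CriticalPhenomena.Ising3DConformalLimit.Theorems.PrecisionLaplacianInverseMCriticalKernel
import Summits.CriticalPhenomena.Ising3DConformalLimit.Theorems.PrecisionLaplacianPrecisionIsLaplacian
import Literature.Probability.LatticeModels.PointwiseScalingLimitEtaExists
import Literature.Probability.LatticeModels.CriticalAxisRatioRegularity
import Literature.Probability.LatticeModels.CriticalTwoPointLawDimension
import Literature.Probability.LatticeModels.CriticalTwoPointLower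
import Literature.Probability.LatticeModels.HighDimPointwiseTriviality

/-!
# Crux `PerfectScreening.SubharmonicOffOrigin` (stmt-CriticalPhenomena-1341), line
`direct-correlation-shells`: stub `stub_unitRate` (positivity of the nearest-neighbour direct correlation)

This file proves the registered stub `stub_unitRate` of the planner's checked skeleton
`Cruxes/SubharmonicOffOrigin/Lines/direct_correlation_shells.lean`:
under the inverse-M conjecture `InverseMFerromagnet` (item 4798 of route `PrecisionLaplacian`, taken as
HYPOTHESIS) the canonical direct-correlation function of the critical `ℤ³` Ising two-point function
`G = criticalTwoPoint 3` is POSITIVE at the unit step: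
`0 < a(e₀) = inf_{A ∋ 0, e₀} −(G_A⁻¹)(0, e₀)`, `G_A = (G(q − p))_{p,q ∈ A}`.

## Proof (elementary linear algebra of inverse M-matrices + lattice symmetries + MMS maximality)

Write `f(A) = −(G_A⁻¹)(0,e₀)`. By item 4802 (`InverseMCriticalKernel_proof`, landed) every `G_A` is positive
definite and `G_A⁻¹` is a Z-matrix with nonnegative row sums.
1. MONOTONICITY (`pil_inv_mono`, iterated bordering of inverse M-matrices): `A ⊆ A' ⇒ f(A) ≥ f(A')`; so it
   suffices to bound `f(B)` below for the symmetric boxes `B = {−R,…,R}³ ⊇ A`.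
2. THE BOX BOUND `f(B) ≥ (G(e₀) − G(2e₀))/6` (`unitRate_box_bound`). Let `D = (G_B⁻¹)(0,0)`,
   `c_w = −(G_B⁻¹)(0,w) ≥ 0` (`w ≠ 0`). Row `0` of `G_B⁻¹ G_B = 1` at column `0` gives `D ≥ 1`, at column
   `e₀` gives `D·G(e₀) = Σ_{w ≠ 0} c_w G(e₀ − w)`; the row sum gives `Σ_{w≠0} c_w ≤ D`. Bound `G(e₀ − w)` by
   `1` at `w = e₀`, by `G(2e₀)` when `w₀ < 0` (MMS sphere sandwich + axis antitonicity, `‖e₀ − w‖∞ ≥ 2`) and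
   by `G(e₀) = max_{z ≠ 0} G` otherwise. The hyperoctahedral symmetries of `B` fixing `0` leave `c` invariant
   (transport of the inverse Gram matrix, `Matrix.inv_reindex`): the reflection `w₀ ↦ −w₀` shows that the
   half spaces `{w₀ > 0}` and `{w₀ < 0}` carry the same `c`-mass, and the transpositions `(0 1)`, `(0 2)` show
   that the three coordinate planes `{wᵢ = 0}` carry the same `c`-mass, hence each at most `2/3` of the
   total (a nonzero site lies on at most two of them). Linear bookkeeping then gives
   `c_{e₀} ≥ D (G(e₀) − G(2e₀))/6 ≥ (G(e₀) − G(2e₀))/6`.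
3. STRICT AXIS DECREASE `G(2e₀) < G(e₀)` (`unitRate_axis_two_lt_one`): the axis ratios
   `G((k+2)e₀)/G((k+1)e₀)` are nondecreasing (log-convexity, `criticalTwoPoint_axis_ratio_mono`), so
   `G(2e₀) ≥ G(e₀)` would force `G(ne₀) ≥ G(e₀) > 0` for all `n ≥ 1`, against `G → 0`
   (`criticalTwoPoint_tendsto_zero_cofinite`).

References: Dellacherie–Martínez–San Martín, *Inverse M-matrices and ultrametric matrices*, LNM 2118
(2014), Lemma 2.32; Messager–Miracle-Solé, J. Stat. Phys. 17 (1977); Aizenman–Duminil-Copin, Ann. of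
Math. 194 (2021), Prop. 5.3.
-/

noncomputable section

open Filter Topology Finset
open Literature.Probability.LatticeModels
open Literature.Probability.Percolation (signedPerm_mem_box_iff)

namespace Summit.CriticalPhenomena.Ising3DConformalLimit.Theorems.PerfectScreening.DcsUnitRate

/-! ## Transport of inverse Gram matrices under symmetries of a stable index set -/

section Abstract

variable {G : Site 3 → ℝ} {r : Finset (Site 3) → Site 3 → ℝ}

/-- Transport of the inverse Gram matrix `(G(q − p))⁻¹_{p,q ∈ B}` under an additive bijection `φ` of `ℤ³`
leaving `G` invariant and the index set `B` stable: `(G_B⁻¹)(φ a, φ b) = (G_B⁻¹)(a, b)`. -/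
theorem unitRate_inv_entry_equiv (φ : Site 3 ≃ Site 3)
    (hsub : ∀ p q : Site 3, φ (q - p) = φ q - φ p) (hG : ∀ z, G (φ z) = G z)
    (B : Finset (Site 3)) (hB : ∀ y, φ y ∈ B ↔ y ∈ B) (a b : ↥B) :
    (Matrix.of fun p q : ↥B => G (q.1 - p.1))⁻¹ ⟨φ a.1, (hB a.1).2 a.2⟩ ⟨φ b.1, (hB b.1).2 b.2⟩ =
      (Matrix.of fun p q : ↥B => G (q.1 - p.1))⁻¹ a b := by
  let e : ↥B ≃ ↥B := φ.subtypeEquiv fun y => (hB y).symm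
  have hsub' : ∀ p q : Site 3, φ.symm q - φ.symm p = φ.symm (q - p) := fun p q =>
    φ.injective (by rw [hsub, φ.apply_symm_apply, φ.apply_symm_apply, φ.apply_symm_apply])
  have hM : (Matrix.of fun p q : ↥B => G (q.1 - p.1)) =
      Matrix.reindex e e (Matrix.of fun p q : ↥B => G (q.1 - p.1)) := by
    ext q q'
    simp only [Matrix.reindex_apply, Matrix.submatrix_apply, Matrix.of_apply, e,
      Equiv.subtypeEquiv_symm, Equiv.subtypeEquiv_apply]
    rw [hsub', ← hG (φ.symm _), φ.apply_symm_apply]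
  have ha : e.symm ⟨φ a.1, (hB a.1).2 a.2⟩ = a := Subtype.ext (φ.symm_apply_apply a.1)
  have hb : e.symm ⟨φ b.1, (hB b.1).2 b.2⟩ = b := Subtype.ext (φ.symm_apply_apply b.1)
  conv_lhs => rw [hM, Matrix.inv_reindex, Matrix.reindex_apply, Matrix.submatrix_apply, ha, hb]

/-- Invariance of the origin row `r B y = (G_B⁻¹)(0, y)` (extended by `0` off `B`) under an additive
bijection `φ` of `ℤ³` leaving `G` invariant and `B` stable. -/
theorem unitRate_row_symm
    (hr : ∀ A y, r A y = if h : (0 : Site 3) ∈ A ∧ y ∈ A then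
      (Matrix.of fun p q : ↥A => G (q.1 - p.1))⁻¹ ⟨0, h.1⟩ ⟨y, h.2⟩ else 0)
    (φ : Site 3 ≃ Site 3) (hsub : ∀ p q : Site 3, φ (q - p) = φ q - φ p)
    (hG : ∀ z, G (φ z) = G z) (B : Finset (Site 3)) (hB : ∀ y, φ y ∈ B ↔ y ∈ B) (y : Site 3) :
    r B (φ y) = r B y := by
  have hφ0 : φ 0 = 0 := by simpa using hsub 0 0
  by_cases h0 : (0 : Site 3) ∈ B
  · by_cases hy : y ∈ B
    · rw [hr, hr, dif_pos ⟨h0, (hB y).2 hy⟩, dif_pos ⟨h0, hy⟩]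
      have key := unitRate_inv_entry_equiv φ hsub hG B hB ⟨0, h0⟩ ⟨y, hy⟩
      have e0 : (⟨φ 0, (hB 0).2 h0⟩ : ↥B) = ⟨0, h0⟩ := Subtype.ext hφ0
      rwa [e0] at key
    · rw [hr, hr, dif_neg fun h => hy ((hB y).1 h.2), dif_neg fun h => hy h.2]
  · rw [hr, hr, dif_neg fun h => h0 h.1, dif_neg fun h => h0 h.1]

/-! ## The symmetric-box bound -/

/-- Signed permutations are additive (subtraction form). -/
theorem unitRate_signedPerm_sub (π : Equiv.Perm (Fin 3)) (ε : Fin 3 → ℤˣ) (p q : Site 3) :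
    Site.signedPerm π ε (q - p) = Site.signedPerm π ε q - Site.signedPerm π ε p := by
  funext i
  simp [Site.signedPerm_apply, mul_sub]

/-- A signed permutation fixes only the origin among `{0}`: `φ y = 0 ↔ y = 0`. -/
theorem unitRate_signedPerm_eq_zero (π : Equiv.Perm (Fin 3)) (ε : Fin 3 → ℤˣ) (y : Site 3) :
    Site.signedPerm π ε y = 0 ↔ y = 0 :=
  (Site.signedPerm π ε).injective.eq_iff' (Site.signedPerm_zero π ε)

/-- **The symmetric-box bound.** For a kernel `G ≥ 0` with `G 0 = 1`, invariant under the signed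
permutations of `ℤ³`, maximal off the origin at a site `e` with `e 0 = 1` and bounded by `g₂ ≤ G e` on
`{z | 2 ≤ z 0}`, and an origin row `r B` of `G_B⁻¹` on the box `B = {−R,…,R}³` which is a Z-row with
nonnegative row sum, satisfies the row identities `Σ_y r B y · G(z − y) = δ_{0z}` and is invariant under the
signed permutations: `−r B e ≥ (G e − g₂)/6`. -/
theorem unitRate_box_bound (hG0 : ∀ x, 0 ≤ G x) (hG00 : G 0 = 1) {e : Site 3} (he : e 0 = 1)
    (hmax : ∀ z, z ≠ 0 → G z ≤ G e) {g₂ : ℝ} (hg₂ : 0 ≤ g₂) (hg₂e : g₂ ≤ G e)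
    (hfar : ∀ z : Site 3, 2 ≤ z 0 → G z ≤ g₂) (R : ℕ) (heB : e ∈ box 3 R)
    (hrZ : ∀ y, y ≠ 0 → r (box 3 R) y ≤ 0)
    (hrsum : 0 ≤ ∑ y ∈ box 3 R, r (box 3 R) y)
    (hrid : ∀ z ∈ box 3 R, ∑ y ∈ box 3 R, r (box 3 R) y * G (z - y) = if z = 0 then 1 else 0)
    (hrsymm : ∀ (π : Equiv.Perm (Fin 3)) (ε : Fin 3 → ℤˣ) (y : Site 3),
      r (box 3 R) (Site.signedPerm π ε y) = r (box 3 R) y) :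
    (G e - g₂) / 6 ≤ -r (box 3 R) e := by
  have h0 : (0 : Site 3) ∈ box 3 R := by simp [mem_box]
  have he0 : e ≠ 0 := by
    intro h
    rw [h, Pi.zero_apply] at he
    exact zero_ne_one he
  have he0S : e ∈ (box 3 R).erase 0 := Finset.mem_erase.2 ⟨he0, heB⟩
  have hS : ∀ y ∈ (box 3 R).erase 0, y ≠ 0 ∧ y ∈ box 3 R := fun y hy => Finset.mem_erase.1 hy
  have hrS : ∀ y ∈ (box 3 R).erase 0, r (box 3 R) y ≤ 0 := fun y hy => hrZ y (hS y hy).1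
  -- (I) the diagonal entry is at least `1`
  have hI : 1 ≤ r (box 3 R) 0 := by
    have h := hrid 0 h0
    rw [if_pos rfl, ← Finset.add_sum_erase _ _ h0, sub_zero, hG00, mul_one] at h
    have hle : ∑ y ∈ (box 3 R).erase 0, r (box 3 R) y * G (0 - y) ≤ 0 :=
      Finset.sum_nonpos fun y hy => mul_nonpos_of_nonpos_of_nonneg (hrS y hy) (hG0 _)
    linarith
  -- (III) the row sum is nonnegative
  have hIII : 0 ≤ r (box 3 R) 0 + ∑ y ∈ (box 3 R).erase 0, r (box 3 R) y := by
    rwa [← Finset.add_sum_erase _ _ h0] at hrsum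
  -- (II) the row identity at column `e`
  have hII : r (box 3 R) 0 * G e + ∑ y ∈ (box 3 R).erase 0, r (box 3 R) y * G (e - y) = 0 := by
    have h := hrid e heB
    rwa [if_neg he0, ← Finset.add_sum_erase _ _ h0, sub_zero] at h
  -- the pieces of the row
  set D := r (box 3 R) 0 with hD
  set T := ∑ y ∈ (box 3 R).erase 0, r (box 3 R) y with hT
  set N := ∑ y ∈ (box 3 R).erase 0, (if y 0 < 0 then r (box 3 R) y else 0) with hN
  set P := ∑ y ∈ (box 3 R).erase 0, (if 0 < y 0 then r (box 3 R) y else 0) with hP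
  set Z0 := ∑ y ∈ (box 3 R).erase 0, (if y 0 = 0 then r (box 3 R) y else 0) with hZ0
  set Z1 := ∑ y ∈ (box 3 R).erase 0, (if y 1 = 0 then r (box 3 R) y else 0) with hZ1
  set Z2 := ∑ y ∈ (box 3 R).erase 0, (if y 2 = 0 then r (box 3 R) y else 0) with hZ2
  have hTsplit : T = N + P + Z0 := by
    rw [hT, hN, hP, hZ0, ← Finset.sum_add_distrib, ← Finset.sum_add_distrib]
    refine Finset.sum_congr rfl fun y _ => ?_
    rcases lt_trichotomy (y 0) 0 with h | h | h
    · simp [h, lt_asymm h, h.ne]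
    · simp [h]
    · simp [h, lt_asymm h, h.ne']
  -- termwise lower bound of the column-`e` sum
  have hkey : r (box 3 R) e + g₂ * N + G e * P + G e * Z0 ≤
      ∑ y ∈ (box 3 R).erase 0, r (box 3 R) y * G (e - y) := by
    have hsum : ∑ y ∈ (box 3 R).erase 0, ((if y = e then r (box 3 R) y else 0) +
        g₂ * (if y 0 < 0 then r (box 3 R) y else 0) + G e * (if 0 < y 0 then r (box 3 R) y else 0) +
        G e * (if y 0 = 0 then r (box 3 R) y else 0)) =
        r (box 3 R) e + g₂ * N + G e * P + G e * Z0 := by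
      rw [Finset.sum_add_distrib, Finset.sum_add_distrib, Finset.sum_add_distrib, Finset.sum_ite_eq',
        if_pos he0S, hN, hP, hZ0, ← Finset.mul_sum, ← Finset.mul_sum, ← Finset.mul_sum]
    rw [← hsum]
    refine Finset.sum_le_sum fun y hy => ?_
    have hr0 := hrS y hy
    have hGe := hG0 e
    by_cases hye : y = e
    · rw [hye, if_pos rfl, if_neg (by rw [he]; norm_num), if_pos (by rw [he]; norm_num),
        if_neg (by rw [he]; norm_num), sub_self, hG00]
      rw [hye] at hr0
      nlinarith
    · rw [if_neg hye]
      rcases lt_trichotomy (y 0) 0 with h | h | h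
      · rw [if_pos h, if_neg (lt_asymm h), if_neg h.ne]
        have h2 : 2 ≤ (e - y) 0 := by rw [Pi.sub_apply, he]; omega
        have := hfar (e - y) h2
        nlinarith
      · rw [if_neg (by rw [h]; exact lt_irrefl 0), if_neg (by rw [h]; exact lt_irrefl 0), if_pos h]
        have := hmax (e - y) (sub_ne_zero.2 (Ne.symm hye))
        nlinarith
      · rw [if_neg (lt_asymm h), if_pos h, if_neg h.ne']
        have := hmax (e - y) (sub_ne_zero.2 (Ne.symm hye))
        nlinarith
  -- symmetry 1: the reflection `y₀ ↦ −y₀` exchanges the two half spaces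
  have hNP : N = P := by
    have hρ0 : ∀ y : Site 3,
        Site.signedPerm (Equiv.refl (Fin 3)) (Function.update 1 0 (-1)) y 0 = -y 0 := fun y => by
      simp [Site.signedPerm_apply]
    refine Finset.sum_equiv (Site.signedPerm (Equiv.refl (Fin 3)) (Function.update 1 0 (-1)))
      (fun y => ?_) (fun y _ => ?_)
    · simp only [Finset.mem_erase, ne_eq, unitRate_signedPerm_eq_zero, signedPerm_mem_box_iff]
    · simp only [hρ0, neg_pos, hrsymm]
  -- symmetry 2: the transpositions `(0 1)`, `(0 2)` exchange the coordinate planes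
  have hZ01 : Z0 = Z1 := by
    have hσ1 : ∀ y : Site 3, Site.signedPerm (Equiv.swap 0 1) 1 y 1 = y 0 := fun y => by
      simp [Site.signedPerm_apply]
    refine Finset.sum_equiv (Site.signedPerm (Equiv.swap 0 1) 1) (fun y => ?_) (fun y _ => ?_)
    · simp only [Finset.mem_erase, ne_eq, unitRate_signedPerm_eq_zero, signedPerm_mem_box_iff]
    · simp only [hσ1, hrsymm]
  have hZ02 : Z0 = Z2 := by
    have hσ2 : ∀ y : Site 3, Site.signedPerm (Equiv.swap 0 2) 1 y 2 = y 0 := fun y => by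
      simp [Site.signedPerm_apply]
    refine Finset.sum_equiv (Site.signedPerm (Equiv.swap 0 2) 1) (fun y => ?_) (fun y _ => ?_)
    · simp only [Finset.mem_erase, ne_eq, unitRate_signedPerm_eq_zero, signedPerm_mem_box_iff]
    · simp only [hσ2, hrsymm]
  -- a nonzero site lies on at most two coordinate planes
  have hcount : Z0 + Z1 + Z2 ≥ 2 * T := by
    rw [hT, hZ0, hZ1, hZ2, Finset.mul_sum, ← Finset.sum_add_distrib, ← Finset.sum_add_distrib]
    refine Finset.sum_le_sum fun y hy => ?_
    have hy0 := (hS y hy).1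
    have hr0 := hrS y hy
    by_cases h0 : y 0 = 0 <;> by_cases h1 : y 1 = 0 <;> by_cases h2 : y 2 = 0 <;>
      simp only [h0, h1, h2, if_true, if_false] <;> try linarith
    exfalso
    apply hy0
    funext i
    fin_cases i <;> assumption
  have hN0 : N ≤ 0 := Finset.sum_nonpos fun y hy => by
    split_ifs
    · exact hrS y hy
    · exact le_rfl
  have hZ00 : Z0 ≤ 0 := Finset.sum_nonpos fun y hy => by
    split_ifs
    · exact hrS y hy
    · exact le_rfl
  -- linear bookkeeping
  have p1 : 0 ≤ (3 * Z0 - 2 * T) * (G e - g₂) := mul_nonneg (by linarith) (by linarith)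
  have p2 : 0 ≤ (D + T) * (5 * G e + g₂) := mul_nonneg hIII (by linarith [hG0 e])
  have p3 : 0 ≤ (D - 1) * (G e - g₂) := mul_nonneg (by linarith) (by linarith)
  nlinarith [p1, p2, p3, hkey, hII, hTsplit, hNP, hZ01, hZ02, hcount]

end Abstract

/-! ## Inputs on the critical two-point function of `ℤ³` -/

/-- A nonzero site has sup norm `≥ 1`. -/
theorem unitRate_one_le_supNorm {z : Site 3} (hz : z ≠ 0) : 1 ≤ Site.supNorm z := by
  by_contra h
  apply hz
  funext i
  have h1 := Site.natAbs_le_supNorm z i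
  have h2 : (z i).natAbs = 0 := by omega
  exact Int.natAbs_eq_zero.1 h2

/-- MAXIMALITY (Messager–Miracle-Solé): `G(z) ≤ G(e₀)` for every `z ≠ 0` (sphere sandwich
`G(z) ≤ G(‖z‖∞ e₀)` + axis antitonicity). -/
theorem unitRate_G_le_G_e0 {z : Site 3} (hz : z ≠ 0) :
    criticalTwoPoint 3 z ≤ criticalTwoPoint 3 (Pi.single 0 1) := by
  have hn := unitRate_one_le_supNorm hz
  have h1 := (criticalTwoPoint_axis_sandwich hn).2
  have h2 : criticalTwoPoint 3 (Pi.single 0 ((Site.supNorm z : ℕ) : ℤ)) ≤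
      criticalTwoPoint 3 (Pi.single 0 ((1 : ℕ) : ℤ)) := criticalTwoPoint_axis_antitone hn
  rw [Nat.cast_one] at h2
  exact h1.trans h2

/-- FAR BOUND: `G(z) ≤ G(2e₀)` whenever `z 0 ≥ 2` (sphere sandwich + axis antitonicity, `‖z‖∞ ≥ 2`). -/
theorem unitRate_G_le_G_two {z : Site 3} (hz : 2 ≤ z 0) :
    criticalTwoPoint 3 z ≤ criticalTwoPoint 3 (Pi.single 0 2) := by
  have hn : 2 ≤ Site.supNorm z := by
    have h := Site.natAbs_le_supNorm z 0
    omega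
  have h1 := (criticalTwoPoint_axis_sandwich (y := z) (by omega)).2
  have h2 : criticalTwoPoint 3 (Pi.single 0 ((Site.supNorm z : ℕ) : ℤ)) ≤
      criticalTwoPoint 3 (Pi.single 0 ((2 : ℕ) : ℤ)) := criticalTwoPoint_axis_antitone hn
  rw [Nat.cast_ofNat] at h2
  exact h1.trans h2

/-- STRICT AXIS DECREASE `G(2e₀) < G(e₀)`: the axis ratios `G((k+2)e₀)/G((k+1)e₀)` are nondecreasing
(log-convexity), so `G(2e₀) ≥ G(e₀)` would force `G(ne₀) ≥ G(e₀) > 0` for all `n ≥ 1`, against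
`G → 0`. -/
theorem unitRate_axis_two_lt_one :
    criticalTwoPoint 3 (Pi.single 0 2) < criticalTwoPoint 3 (Pi.single 0 1) := by
  set g : ℕ → ℝ := fun n => criticalTwoPoint 3 (Pi.single 0 (n : ℤ)) with hg
  have hpos : ∀ n, 0 < g n := fun n => criticalTwoPoint_axis_pos n
  have hmono : Monotone fun k : ℕ => g (k + 2) / g (k + 1) := by
    intro a b hab
    have h := criticalTwoPoint_axis_ratio_mono (0 : Fin 3) hab
    simpa only [hg] using h
  have h21 : g 2 = criticalTwoPoint 3 (Pi.single 0 2) := by simp [hg]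
  have h11 : g 1 = criticalTwoPoint 3 (Pi.single 0 1) := by simp [hg]
  rw [← h21, ← h11]
  by_contra hge
  push Not at hge
  have hall : ∀ k : ℕ, g 1 ≤ g (k + 1) := by
    intro k
    induction k with
    | zero => exact le_rfl
    | succ k ih =>
      have hk : g (0 + 2) / g (0 + 1) ≤ g (k + 2) / g (k + 1) := hmono (Nat.zero_le k)
      have h1 : 1 ≤ g (0 + 2) / g (0 + 1) := by
        rw [Nat.zero_add, Nat.zero_add, le_div_iff₀ (hpos 1), one_mul]
        exact hge
      have h2 : 1 ≤ g (k + 2) / g (k + 1) := h1.trans hk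
      rw [le_div_iff₀ (hpos (k + 1)), one_mul] at h2
      exact ih.trans h2
  -- but `G → 0` along the (injective) axis sequence
  have hinj : Function.Injective (fun n : ℕ => (Pi.single 0 ((n + 1 : ℕ) : ℤ) : Site 3)) := by
    intro a b hab
    have h := congrFun hab 0
    simp at h
    omega
  have ht := criticalTwoPoint_tendsto_zero_cofinite.comp hinj.tendsto_cofinite
  rw [Nat.cofinite_eq_atTop] at ht
  have hev := ht.eventually (eventually_lt_nhds (hpos 1))
  obtain ⟨n, hn⟩ := hev.exists
  simp only [Function.comp_apply] at hn
  exact absurd (hall n) (not_le.2 hn)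

/-! ## The uniform lower bound and the registered stub -/

/-- **Uniform lower bound.** Under the symmetric-potential property of the critical kernel (conclusion of
item 4802), `−(G_A⁻¹)(0, e₀) ≥ (G(e₀) − G(2e₀))/6` for every finite `A ∋ 0, e₀`. -/
theorem unitRate_uniform
    (HP : ∀ A : Finset (Site 3), (Matrix.of fun p q : ↥A => criticalTwoPoint 3 (q.1 - p.1)).PosDef ∧
      ∀ u v : ↥A, (u ≠ v → (Matrix.of fun p q : ↥A => criticalTwoPoint 3 (q.1 - p.1))⁻¹ u v ≤ 0) ∧
        0 ≤ ∑ w, (Matrix.of fun p q : ↥A => criticalTwoPoint 3 (q.1 - p.1))⁻¹ u w)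
    (A : Finset (Site 3)) (h0 : (0 : Site 3) ∈ A) (h1 : (Pi.single 0 1 : Site 3) ∈ A) :
    (criticalTwoPoint 3 (Pi.single 0 1) - criticalTwoPoint 3 (Pi.single 0 2)) / 6 ≤
      -((Matrix.of fun p q : ↥A => criticalTwoPoint 3 (q.1 - p.1))⁻¹ ⟨0, h0⟩ ⟨Pi.single 0 1, h1⟩) := by
  have hG0 : ∀ x, 0 ≤ criticalTwoPoint 3 x := fun x => criticalTwoPoint_nonneg' x
  -- the origin rows of the inverse Gram matrices
  set r : Finset (Site 3) → Site 3 → ℝ := fun A y =>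
    if h : (0 : Site 3) ∈ A ∧ y ∈ A then
      (Matrix.of fun p q : ↥A => criticalTwoPoint 3 (q.1 - p.1))⁻¹ ⟨0, h.1⟩ ⟨y, h.2⟩ else 0 with hrdef
  have hr : ∀ A y, r A y = if h : (0 : Site 3) ∈ A ∧ y ∈ A then
      (Matrix.of fun p q : ↥A => criticalTwoPoint 3 (q.1 - p.1))⁻¹ ⟨0, h.1⟩ ⟨y, h.2⟩ else 0 :=
    fun A y => rfl
  -- a symmetric box containing `A`
  set R : ℕ := A.sup fun y => Site.supNorm y with hR
  have hAB : A ⊆ box 3 R := fun y hy =>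
    mem_box_iff_supNorm_le.2 (Finset.le_sup (f := fun y => Site.supNorm y) hy)
  have h0B : (0 : Site 3) ∈ box 3 R := hAB h0
  have h1B : (Pi.single 0 1 : Site 3) ∈ box 3 R := hAB h1
  -- monotonicity: `(G_A⁻¹)(0,e₀) ≤ (G_B⁻¹)(0,e₀) = r B e₀`
  have hmono := Summit.CriticalPhenomena.Ising3DConformalLimit.Theorems.pil_inv_mono hG0 HP hAB
    ⟨0, h0⟩ ⟨Pi.single 0 1, h1⟩
  have hrB : r (box 3 R) (Pi.single 0 1) =
      (Matrix.of fun p q : ↥(box 3 R) => criticalTwoPoint 3 (q.1 - p.1))⁻¹ ⟨0, h0B⟩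
        ⟨Pi.single 0 1, h1B⟩ := by
    rw [hr, dif_pos ⟨h0B, h1B⟩]
  -- the box bound
  have hbox : (criticalTwoPoint 3 (Pi.single 0 1) - criticalTwoPoint 3 (Pi.single 0 2)) / 6 ≤
      -r (box 3 R) (Pi.single 0 1) := by
    refine unitRate_box_bound (r := r) hG0 criticalTwoPoint_zero' (by simp)
      (fun z hz => unitRate_G_le_G_e0 hz) (hG0 _) unitRate_axis_two_lt_one.le
      (fun z hz => unitRate_G_le_G_two hz) R h1B
      (fun y hy => Summit.CriticalPhenomena.Ising3DConformalLimit.Theorems.pil_rZ HP hr _ y hy)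
      (Summit.CriticalPhenomena.Ising3DConformalLimit.Theorems.pil_rsum HP hr _ h0B)
      (fun z hz => Summit.CriticalPhenomena.Ising3DConformalLimit.Theorems.pil_rid HP hr _ h0B z hz)
      (fun π ε y => ?_)
    exact unitRate_row_symm hr (Site.signedPerm π ε) (unitRate_signedPerm_sub π ε)
      (fun z => twoPointPlus_signedPerm (criticalBeta 3) π ε z) (box 3 R)
      (fun y => signedPerm_mem_box_iff π ε) y
  rw [hrB] at hbox
  linarith

/-- STUB `stub_unitRate` of line `direct-correlation-shells` (crux stmt-CriticalPhenomena-1341), verbatim: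
under `InverseMFerromagnet` (item 4798) the nearest-neighbour direct correlation
`a₁ = inf_{A ∋ 0, e₀} −(G_A⁻¹)(0, e₀)` of the critical `ℤ³` Ising two-point function is positive; indeed
`a₁ ≥ (G(e₀) − G(2e₀))/6 > 0`. -/
theorem stub_unitRate : Summit.CriticalPhenomena.Ising3DConformalLimit.Theses.PrecisionLaplacian.InverseMFerromagnet →
    0 < (⨅ A : {A : Finset (Literature.Probability.LatticeModels.Site 3) // (0 : Literature.Probability.LatticeModels.Site 3) ∈ A ∧ (Pi.single 0 1 : Literature.Probability.LatticeModels.Site 3) ∈ A}, -((Matrix.of fun (p q : ↥A.1) => Literature.Probability.LatticeModels.criticalTwoPoint 3 (q.1 - p.1))⁻¹ ⟨0, A.2.1⟩ ⟨(Pi.single 0 1 : Literature.Probability.LatticeModels.Site 3), A.2.2⟩)) := by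
  intro hIM
  have HP := Summit.CriticalPhenomena.Ising3DConformalLimit.Theorems.InverseMCriticalKernel_proof hIM
  have hκ : 0 < (criticalTwoPoint 3 (Pi.single 0 1) - criticalTwoPoint 3 (Pi.single 0 2)) / 6 := by
    have := unitRate_axis_two_lt_one
    linarith
  haveI : Nonempty {A : Finset (Site 3) // (0 : Site 3) ∈ A ∧ (Pi.single 0 1 : Site 3) ∈ A} :=
    ⟨⟨{0, Pi.single 0 1}, by simp, by simp⟩⟩
  exact lt_of_lt_of_le hκ (le_ciInf fun A => unitRate_uniform HP A.1 A.2.1 A.2.2)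

end Summit.CriticalPhenomena.Ising3DConformalLimit.Theorems.PerfectScreening.DcsUnitRate

end
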